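import Literature.Computability.AlgebraicComplexity.ValiantConjecture
import Literature.Computability.AlgebraicComplexity.ArithCircuitProofs
import HarnessLib

/-!
# `PER ∈ VNP`: discharge of `Literature.Computability.AlgebraicComplexity.perFamily_mem_VNP` and `Literature.Computability.AlgebraicComplexity.isVNPFamily_perPoly`

D-0014 keeps `Literature/` sorry-free by stating cited results as named facts `def X : Prop`.
This sibling file of `Literature.Computability.AlgebraicComplexity.ValiantConjecture` proves
Valiant's theorem that the permanent family is p-definable,

* `Literature.PNP.isVNPFamily_perPoly_holds : isVNPFamily_perPoly k` (`IsVNPFamily (PER_n)_n`),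
* `Literature.PNP.perFamily_mem_VNP_holds : perFamily_mem_VNP k` (`perFamily k ∈ VNP k`),

over every field `k` (in fact over every commutative ring, `isVNPFamily_perPoly_of_commRing`),
together with the p-family half `Literature.Computability.AlgebraicComplexity.isPFamily_perPoly_holds` of `StandardFamilies.lean`.

## The printed proof and the one formalised

Bürgisser–Clausen–Shokrollahi 1997, Prop. (21.15) ("PER and HC belong to VNP", p. 548–549)
writes `PER_n(X) = ∑_{e ∈ {0,1}^{n×n}} g_n(X, e)` (step (D)) with
`g_n(X, Y) = γ_n(Y) · μ_n(X, Y)`, `μ_n = ∏_i ∑_j X_{ij} Y_{ij}`, where `γ_n = α_n β_n` is a small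
circuit recognising permutation matrices (steps (A)–(C)), and `g ∈ VP` because
`v(g_n) = 2n²`, `deg g_n = O(n³)`, `L(g_n) = O(n³)`. We use the same scheme (a Boolean sum
of a product of a *selector* polynomial in the Boolean variables and a *cover* polynomial
`∏_i ∑_j Y_j X_{ji}`), but with only `n` Boolean variables `Y_1, …, Y_n` and the sign selector
`∏_j (2 Y_j - 1)`: for `e ∈ {0,1}^n` with support `S`,
`g_n(X, e) = (-1)^{n - |S|} ∏_i ∑_{j ∈ S} X_{ji}`, and

  `∑_{S ⊆ [n]} (-1)^{n-|S|} ∏_i ∑_{j ∈ S} X_{ji} = ∑_{f : [n] → [n]} [f surjective] ∏_i X_{f(i), i} = PER_n(X)`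

by inclusion–exclusion (`∑_{S ⊇ range f} (-1)^{n-|S|} = [range f = [n]]`). This is Ryser's
formula, BCS 1997, Rem. (21.16)(2) (p. 549) and Ex. 21.1 (§21.6, p. 572): `PER_n = ∑_J (-1)^{|J|}
∏_i ∑_{j ∉ J} X_{ij}`, the sum over all proper subsets `J ⊂ [n]` (with `J = [n] ∖ S`; the term
`S = ∅` vanishes for `n ≥ 1`, and we use the transpose, which does not change the permanent). The
witness `g_n` has `n² + n` variables, degree `≤ 3n` and complexity `≤ 2n² + 4n + 1` (BCS 1997,
Def. (21.3) with Convention (21.5): division- and subtraction-free straight-line programs, inputs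
and constants free), so it is in `VP` (`isVPFamily_perVNPWitness`, via the cost lemmas of
`ArithCircuitProofs.lean` and `IsPBounded.iff_exists_le_mul_succ_pow`), and
`PER_n = ∑_e g_n(X, e)` is
`boolSum_perVNPWitness`; this is literally Bürgisser 2000, Def. 2.5 (= `IsVNPFamily`), whence
`IsVNPFamily (PER_n)` and, by `mem_VNP_ofFintype_iff_holds` (`ValiantClasses.lean`),
`perFamily k ∈ VNP k`. No characteristic hypothesis is used (Field `k` only because the facts
are stated over fields; the proof is over any commutative ring).

## References

* L. G. Valiant, *Completeness classes in algebra*, Proc. 11th STOC (1979), 249–261.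
* P. Bürgisser, M. Clausen, M. A. Shokrollahi, *Algebraic Complexity Theory*, Springer 1997,
  Def. (21.3) and Convention (21.5) p. 546, Prop. (21.15) p. 548–549, Rem. (21.16)(2) p. 549 and
  Ex. 21.1 p. 572 (Ryser's formula).
* P. Bürgisser, *Completeness and Reduction in Algebraic Complexity Theory*, Springer 2000,
  Def. 2.5, §2.1.
* H. J. Ryser, *Combinatorial Mathematics*, Carus Math. Monographs 14, MAA 1963.
-/

noncomputable section

open MvPolynomial

universe u v

namespace Literature.Computability.AlgebraicComplexity

/-! ### Ryser-type inclusion–exclusion identity -/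

section Ryser

variable {R : Type u} [CommRing R] {ι : Type v} [Fintype ι] [DecidableEq ι]

/-- Inclusion–exclusion over subsets `S = {j | e j}` of a finite type: for a map `f : ι → ι`,
`∑_{S ⊇ range f} (-1)^{#ι - |S|} = [f surjective]` (the sign sum behind Ryser's formula;
BCS 1997, Ex. 21.1). [cite: BurgisserClausenShokrollahi1997, Ex. 21.1] -/
theorem sum_bool_sign_mul_indicator (f : ι → ι) :
    ∑ e : ι → Bool, (∏ j, (if e j then (1 : R) else -1)) * (if ∀ i, e (f i) then 1 else 0) =
      if ∀ j, ∃ i, f i = j then 1 else 0 := by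
  -- the constraint `range f ⊆ S` is a product of local constraints over `j`
  have step : ∀ e : ι → Bool, (if ∀ i, e (f i) then (1 : R) else 0) =
      ∏ j, (if ∃ i, f i = j then (if e j then (1 : R) else 0) else 1) := by
    intro e
    by_cases h : ∀ i, e (f i)
    · rw [if_pos h, eq_comm]
      refine Finset.prod_eq_one fun j _ => ?_
      split_ifs with h1 h2
      · rfl
      · obtain ⟨i, rfl⟩ := h1
        exact absurd (h i) h2
      · rfl
    · rw [if_neg h, eq_comm]
      push Not at h
      obtain ⟨i, hi⟩ := h
      refine Finset.prod_eq_zero (Finset.mem_univ (f i)) ?_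
      rw [if_pos ⟨i, rfl⟩, if_neg hi]
  simp_rw [step, ← Finset.prod_mul_distrib]
  -- swap sum and product: `∑_e ∏_j F j (e j) = ∏_j ∑_b F j b`
  have hps := (Fintype.prod_sum (fun (j : ι) (b : Bool) => (if b then (1 : R) else -1) *
      (if ∃ i, f i = j then (if b then (1 : R) else 0) else 1))).symm
  rw [hps]
  have fac : ∀ j, (∑ b : Bool, (if b then (1 : R) else -1) *
      (if ∃ i, f i = j then (if b then (1 : R) else 0) else 1)) = if ∃ i, f i = j then 1 else 0 := by
    intro j
    rw [Fintype.sum_bool]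
    by_cases h : ∃ i, f i = j <;> simp [h]
  simp_rw [fac]
  rw [Finset.prod_boole]
  simp

/-- **Ryser-type formula for the permanent as a signed Boolean sum** (BCS 1997, Rem. (21.16)(2)
and Ex. 21.1; Ryser 1963): for an `ι × ι` array `x` over a commutative ring,
`∑_{e ∈ {0,1}^ι} (∏_j (2 e_j - 1)) ∏_i ∑_j e_j x_{j i} = ∑_{σ ∈ Sym ι} ∏_i x_{σ i, i} = per x`.
The factor `2 e_j - 1` is spelled `e_j + e_j + (-1)`, the shape produced by evaluating the `VNP`
witness `perVNPWitness`. [cite: BurgisserClausenShokrollahi1997, Rem. (21.16)(2)] -/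
theorem sum_bool_sign_prod_sum_eq_sum_perm (x : ι → ι → R) :
    ∑ e : ι → Bool, (∏ j, ((if e j then (1 : R) else 0) + (if e j then (1 : R) else 0) + -1)) *
        ∏ i, ∑ j, (if e j then (1 : R) else 0) * x j i
      = ∑ σ : Equiv.Perm ι, ∏ i, x (σ i) i := by
  have h1 : ∀ b : Bool, ((if b then (1 : R) else 0) + (if b then (1 : R) else 0) + -1) =
      if b then (1 : R) else -1 := by
    rintro (_ | _) <;> norm_num
  have h2 : ∀ (b : Bool) (y : R), (if b then (1 : R) else 0) * y = if b then y else 0 := by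
    rintro (_ | _) y <;> simp
  simp_rw [h1, h2]
  -- expand each product of sums over the choice functions `f : ι → ι`
  have h3 : ∀ e : ι → Bool, (∏ i, ∑ j, if e j then x j i else 0) =
      ∑ f : ι → ι, if ∀ i, e (f i) then ∏ i, x (f i) i else 0 := by
    intro e
    rw [Fintype.prod_sum]
    refine Finset.sum_congr rfl fun f _ => ?_
    rw [Finset.prod_ite_zero]
    simp
  simp_rw [h3, Finset.mul_sum, mul_ite, mul_zero]
  rw [Finset.sum_comm]
  -- for fixed `f`, the signed sum over `e` is the indicator of `f` being surjective
  have h4 : ∀ f : ι → ι, (∑ e : ι → Bool,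
      if ∀ i, e (f i) then (∏ j, if e j then (1 : R) else -1) * ∏ i, x (f i) i else 0) =
        (if ∀ j, ∃ i, f i = j then 1 else 0) * ∏ i, x (f i) i := by
    intro f
    rw [← sum_bool_sign_mul_indicator f, Finset.sum_mul]
    refine Finset.sum_congr rfl fun e _ => ?_
    split_ifs <;> simp
  simp_rw [h4, ite_mul, one_mul, zero_mul]
  rw [← Finset.sum_filter]
  -- surjective self-maps of a finite type are the permutations
  exact Finset.sum_bij
    (fun f hf => Equiv.ofBijective f
      (Function.Surjective.bijective_of_finite (Finset.mem_filter.1 hf).2))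
    (fun _ _ => Finset.mem_univ _)
    (fun a₁ _ a₂ _ h => funext fun i => DFunLike.congr_fun h i)
    (fun σ _ => ⟨σ, Finset.mem_filter.2 ⟨Finset.mem_univ _, σ.surjective⟩, Equiv.ext fun _ => rfl⟩)
    (fun _ _ => rfl)

end Ryser

/-! ### The `VNP` witness for the permanent -/

section Witness

variable (n : ℕ) (k : Type u) [CommRing k]

/-- The sign selector `∏_j (2 Y_j - 1)` in the Boolean variables `Y_j = X (inr j)`, spelled
`Y_j + Y_j + C (-1)` (evaluates to `(-1)^{n - |S|}` at the indicator of `S ⊆ [n]`;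
BCS 1997, proof of Prop. (21.15), rôle of `γ_n`). [cite: BurgisserClausenShokrollahi1997, Prop. (21.15)] -/
def perVNPSign : MvPolynomial ((Fin n × Fin n) ⊕ Fin n) k :=
  ∏ j : Fin n, (X (Sum.inr j) + X (Sum.inr j) + C (-1))

/-- The cover polynomial `μ_n = ∏_i ∑_j Y_j X_{j i}` (BCS 1997, proof of Prop. (21.15), the
factor `μ_n`, here with one Boolean variable per row index `j`). [cite: BurgisserClausenShokrollahi1997, Prop. (21.15)] -/
def perVNPCover : MvPolynomial ((Fin n × Fin n) ⊕ Fin n) k :=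
  ∏ i : Fin n, ∑ j : Fin n, X (Sum.inr j) * X (Sum.inl (j, i))

/-- The `VNP` witness `g_n(X, Y) = (∏_j (2 Y_j - 1)) · ∏_i ∑_j Y_j X_{j i}` for the permanent:
`PER_n(X) = ∑_{e ∈ {0,1}^n} g_n(X, e)` (`boolSum_perVNPWitness`; BCS 1997, Prop. (21.15) with
Ryser's formula, Rem. (21.16)(2)). [cite: BurgisserClausenShokrollahi1997, Prop. (21.15)] -/
def perVNPWitness : MvPolynomial ((Fin n × Fin n) ⊕ Fin n) k :=
  perVNPSign n k * perVNPCover n k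

/-- **`PER_n` is a Boolean sum of the witness**: `∑_{e ∈ {0,1}^n} g_n(X, e) = PER_n(X)`
(BCS 1997, Prop. (21.15) via Ryser's formula, Rem. (21.16)(2) / Ex. 21.1). [cite: BurgisserClausenShokrollahi1997, Prop. (21.15)] -/
theorem boolSum_perVNPWitness : boolSum (perVNPWitness n k) = perPoly (Fin n) k := by
  unfold boolSum perVNPWitness perVNPSign perVNPCover
  simp only [map_mul, map_prod, map_sum, map_add, aeval_X, map_neg, map_one,
    Sum.elim_inl, Sum.elim_inr]
  rw [sum_bool_sign_prod_sum_eq_sum_perm (fun j i => (X (j, i) : MvPolynomial (Fin n × Fin n) k))]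
  simp [perPoly, Matrix.permanent, Matrix.mvPolynomialX]

variable {k}

/-- The total degree of a variable is at most one (over any commutative semiring; equality needs
`Nontrivial`). [folklore] -/
theorem totalDegree_X_le_one {σ : Type v} (s : σ) : (X s : MvPolynomial σ k).totalDegree ≤ 1 :=
  (isHomogeneous_X k s).totalDegree_le

variable (k)

/-- `deg ∏_j (2 Y_j - 1) ≤ n` (BCS 1997, proof of Prop. (21.15), the estimate `g ∈ VP`). [cite: BurgisserClausenShokrollahi1997, Prop. (21.15)] -/
theorem totalDegree_perVNPSign_le : (perVNPSign n k).totalDegree ≤ n := by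
  unfold perVNPSign
  refine (totalDegree_finsetProd _ _).trans ?_
  have h : ∀ j : Fin n, (X (Sum.inr j) + X (Sum.inr j) + C (-1) :
      MvPolynomial ((Fin n × Fin n) ⊕ Fin n) k).totalDegree ≤ 1 := fun j =>
    (totalDegree_add _ _).trans (max_le ((totalDegree_add _ _).trans
      (max_le (totalDegree_X_le_one _) (totalDegree_X_le_one _)))
      (by rw [totalDegree_C]; exact Nat.zero_le _))
  calc ∑ j : Fin n, (X (Sum.inr j) + X (Sum.inr j) + C (-1) :
      MvPolynomial ((Fin n × Fin n) ⊕ Fin n) k).totalDegree ≤ ∑ j : Fin n, 1 :=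
        Finset.sum_le_sum fun j _ => h j
    _ = n := by simp

/-- `deg ∏_i ∑_j Y_j X_{j i} ≤ 2 n` (BCS 1997, proof of Prop. (21.15), the estimate `g ∈ VP`). [cite: BurgisserClausenShokrollahi1997, Prop. (21.15)] -/
theorem totalDegree_perVNPCover_le : (perVNPCover n k).totalDegree ≤ 2 * n := by
  unfold perVNPCover
  refine (totalDegree_finsetProd _ _).trans ?_
  have h : ∀ i : Fin n, (∑ j : Fin n, X (Sum.inr j) * X (Sum.inl (j, i)) :
      MvPolynomial ((Fin n × Fin n) ⊕ Fin n) k).totalDegree ≤ 2 := fun i =>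
    (totalDegree_finsetSum _ _).trans (Finset.sup_le fun j _ =>
      (totalDegree_mul _ _).trans (add_le_add (totalDegree_X_le_one _) (totalDegree_X_le_one _)))
  calc ∑ i : Fin n, (∑ j : Fin n, X (Sum.inr j) * X (Sum.inl (j, i)) :
      MvPolynomial ((Fin n × Fin n) ⊕ Fin n) k).totalDegree ≤ ∑ i : Fin n, 2 :=
        Finset.sum_le_sum fun i _ => h i
    _ = 2 * n := by simp [mul_comm]

/-- `deg g_n ≤ 3 n` (BCS 1997, proof of Prop. (21.15), the estimate `g ∈ VP`). [cite: BurgisserClausenShokrollahi1997, Prop. (21.15)] -/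
theorem totalDegree_perVNPWitness_le : (perVNPWitness n k).totalDegree ≤ 3 * n :=
  (totalDegree_mul _ _).trans (by
    have h1 := totalDegree_perVNPSign_le n k
    have h2 := totalDegree_perVNPCover_le n k
    omega)

/-- `L(∏_j (2 Y_j - 1)) ≤ 3 n`: two additions per factor, `n` multiplications
(BCS 1997, proof of Prop. (21.15), the estimate `g ∈ VP`; cost model Def. (21.3), Convention (21.5)). [cite: BurgisserClausenShokrollahi1997, Prop. (21.15)] -/
theorem complexity_perVNPSign_le : complexity (perVNPSign n k) ≤ 3 * n := by
  unfold perVNPSign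
  refine (complexity_finset_prod_le _ _).trans ?_
  have h : ∀ j : Fin n, complexity (X (Sum.inr j) + X (Sum.inr j) + C (-1) :
      MvPolynomial ((Fin n × Fin n) ⊕ Fin n) k) ≤ 2 := fun j =>
    calc complexity (X (Sum.inr j) + X (Sum.inr j) + C (-1) :
          MvPolynomial ((Fin n × Fin n) ⊕ Fin n) k)
        ≤ complexity (X (Sum.inr j) + X (Sum.inr j) : MvPolynomial ((Fin n × Fin n) ⊕ Fin n) k) +
            complexity (C (-1) : MvPolynomial ((Fin n × Fin n) ⊕ Fin n) k) + 1 :=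
          complexity_add_le_holds _ _
      _ ≤ (complexity (X (Sum.inr j) : MvPolynomial ((Fin n × Fin n) ⊕ Fin n) k) +
            complexity (X (Sum.inr j) : MvPolynomial ((Fin n × Fin n) ⊕ Fin n) k) + 1) +
            complexity (C (-1) : MvPolynomial ((Fin n × Fin n) ⊕ Fin n) k) + 1 := by
          gcongr; exact complexity_add_le_holds _ _
      _ = 2 := by rw [complexity_X_holds, complexity_C_holds]
  calc ∑ j : Fin n, complexity (X (Sum.inr j) + X (Sum.inr j) + C (-1) :
        MvPolynomial ((Fin n × Fin n) ⊕ Fin n) k) + (Finset.univ : Finset (Fin n)).card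
      ≤ ∑ j : Fin n, 2 + (Finset.univ : Finset (Fin n)).card := by
        gcongr with j; exact h j
    _ = 3 * n := by simp; ring

/-- `L(∏_i ∑_j Y_j X_{j i}) ≤ n (2 n) + n`: `n²` multiplications and `n²` additions for the inner
sums, `n` multiplications for the product (BCS 1997, proof of Prop. (21.15), the estimate `g ∈ VP`; cost
model Def. (21.3), Convention (21.5)). [cite: BurgisserClausenShokrollahi1997, Prop. (21.15)] -/
theorem complexity_perVNPCover_le : complexity (perVNPCover n k) ≤ n * (2 * n) + n := by
  unfold perVNPCover
  refine (complexity_finset_prod_le _ _).trans ?_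
  have h : ∀ i : Fin n, complexity (∑ j : Fin n, X (Sum.inr j) * X (Sum.inl (j, i)) :
      MvPolynomial ((Fin n × Fin n) ⊕ Fin n) k) ≤ 2 * n := fun i => by
    refine (complexity_finset_sum_le _ _).trans ?_
    have h' : ∀ j : Fin n, complexity (X (Sum.inr j) * X (Sum.inl (j, i)) :
        MvPolynomial ((Fin n × Fin n) ⊕ Fin n) k) ≤ 1 := fun j =>
      (complexity_mul_le_holds _ _).trans (by rw [complexity_X_holds, complexity_X_holds])
    calc ∑ j : Fin n, complexity (X (Sum.inr j) * X (Sum.inl (j, i)) :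
          MvPolynomial ((Fin n × Fin n) ⊕ Fin n) k) + (Finset.univ : Finset (Fin n)).card
        ≤ ∑ j : Fin n, 1 + (Finset.univ : Finset (Fin n)).card := by
          gcongr with j; exact h' j
      _ = 2 * n := by simp; ring
  calc ∑ i : Fin n, complexity (∑ j : Fin n, X (Sum.inr j) * X (Sum.inl (j, i)) :
        MvPolynomial ((Fin n × Fin n) ⊕ Fin n) k) + (Finset.univ : Finset (Fin n)).card
      ≤ ∑ i : Fin n, 2 * n + (Finset.univ : Finset (Fin n)).card := by
        gcongr with i; exact h i
    _ = n * (2 * n) + n := by simp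

/-- `L(g_n) ≤ 2 n² + 4 n + 1` (BCS 1997, proof of Prop. (21.15), the estimate `g ∈ VP`). [cite: BurgisserClausenShokrollahi1997, Prop. (21.15)] -/
theorem complexity_perVNPWitness_le :
    complexity (perVNPWitness n k) ≤ 3 * n + (n * (2 * n) + n) + 1 :=
  (complexity_mul_le_holds _ _).trans (by
    have h1 := complexity_perVNPSign_le n k
    have h2 := complexity_perVNPCover_le n k
    omega)

/-- **The witness family is in `VP`**: `n² + n` variables, degree `≤ 3 n`, complexity
`≤ 2 n² + 4 n + 1` (BCS 1997, proof of Prop. (21.15), the estimate `g ∈ VP`). [cite: BurgisserClausenShokrollahi1997, Prop. (21.15)] -/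
theorem isVPFamily_perVNPWitness : IsVPFamily fun n => perVNPWitness n k := by
  refine ⟨⟨(IsPBounded.iff_exists_le_mul_succ_pow _).2 ⟨1, 2, fun n => ?_⟩,
    (IsPBounded.iff_exists_le_mul_succ_pow _).2 ⟨3, 1, fun n => ?_⟩⟩,
    (IsPBounded.iff_exists_le_mul_succ_pow _).2 ⟨2, 2, fun n => ?_⟩⟩
  · have h : 1 * (n + 1) ^ 2 = n * n + 2 * n + 1 := by ring
    simp only [Fintype.card_sum, Fintype.card_prod, Fintype.card_fin]
    omega
  · have := totalDegree_perVNPWitness_le n k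
    dsimp only
    rw [pow_one]
    omega
  · have h := complexity_perVNPWitness_le n k
    have h1 : 2 * (n + 1) ^ 2 = 3 * n + (n * (2 * n) + n) + 2 := by ring
    dsimp only
    omega

end Witness

/-- Discharge of `isPFamily_perPoly` (`StandardFamilies.lean`): the permanent family is a p-family,
`n²` variables and degree `≤ n` by homogeneity (Bürgisser 2000, §2.1; BCS 1997, (21.5)). [cite: Burgisser2000, §2.1] -/
theorem isPFamily_perPoly_holds {k : Type u} : isPFamily_perPoly (k := k) := by
  intro _
  refine ⟨(IsPBounded.iff_exists_le_mul_succ_pow _).2 ⟨1, 2, fun m => ?_⟩,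
    (IsPBounded.iff_exists_le_mul_succ_pow _).2 ⟨1, 1, fun m => ?_⟩⟩
  · have h : 1 * (m + 1) ^ 2 = m * m + 2 * m + 1 := by ring
    simp only [Fintype.card_prod, Fintype.card_fin]
    omega
  · dsimp only
    calc (perPoly (Fin m) k).totalDegree ≤ Fintype.card (Fin m) := perPoly_isHomogeneous.totalDegree_le
      _ ≤ 1 * (m + 1) ^ 1 := by simp

/-- **`PER ∈ VNP` over every commutative ring** (Valiant 1979; BCS 1997, Prop. (21.15);
Bürgisser 2000, §2.1): the permanent family is p-definable, with witness `perVNPWitness` and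
Boolean sum of length `n`. [cite: BurgisserClausenShokrollahi1997, Prop. (21.15)] -/
theorem isVNPFamily_perPoly_of_commRing (k : Type u) [CommRing k] :
    IsVNPFamily fun n => perPoly (Fin n) k :=
  ⟨isPFamily_perPoly_holds, fun n => n, fun n => perVNPWitness n k, isVPFamily_perVNPWitness k,
    fun n => (boolSum_perVNPWitness n k).symm⟩

end Literature.Computability.AlgebraicComplexity

namespace Literature.Computability.AlgebraicComplexity


variable (k : Type u) [Field k]

/-- Discharge of `isVNPFamily_perPoly`: the permanent family `(PER_n)_n` is p-definable over every
field (Valiant 1979; BCS 1997, Prop. (21.15); Bürgisser 2000, §2.1). [cite: BurgisserClausenShokrollahi1997, Prop. (21.15)] -/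
theorem isVNPFamily_perPoly_holds : isVNPFamily_perPoly k :=
  isVNPFamily_perPoly_of_commRing k

/-- Discharge of `perFamily_mem_VNP`: the bundled permanent family lies in `VNP k` over every
field (Valiant 1979; BCS 1997, Prop. (21.15); Bürgisser 2000, Thm. 2.10, membership half). [cite: BurgisserClausenShokrollahi1997, Prop. (21.15)] -/
theorem perFamily_mem_VNP_holds : perFamily_mem_VNP k :=
  (mem_VNP_ofFintype_iff_holds _).2 (isVNPFamily_perPoly_holds k)

end Literature.Computability.AlgebraicComplexity
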